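import Summits.QuantumFields.YangMills.Theorems.LuscherReductionTwistedTraceScalingBOStiffQuasimodeFrame
import Summits.QuantumFields.YangMills.Theorems.LuscherReductionTwistedTraceScalingBOStiffCoreMass
import HarnessLib

/-!
# (B-ST) (W1-10 (A4)-algebra) `…BOStiffQuasimodeTwins`: (Q±) from the kernel twins and a two-sided SLICE integral — the β-pointwise bookkeeping of the (A) assembly
# (lane A of S-BASE, crux `TwistedTraceScaling` stmt-QuantumFields-20203, C4-CORE, the (B-ST) pen; (A) split (A4))

At one `β`, abstractly in a bounded measurable kernel `K` (the lead's `cA·cK`), the true kernel `M` (`cM`), the profile `Θ ≥ 0` vanishing off `S` (`cΘ`, `cS`), the weight `w` (`cW`), a Gaussian `g > 0`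
(`e^{−q(x̂)}`) and a normalisation `N` (`gaugeAvg χ (oT 1 x)`):
  twins `(1−ε)K ≤ M ≤ (1+ε)K + t` on `S×S` (`0 ≤ ε ≤ 1`);  slice `∫K(x,·)Θ ≤ (1+σ₁)Λ₀g(x)` on `S`, `(1−σ₁)Λ₀g(x) ≤ ∫K(x,·)Θ` on `I`;  `Θw = g·N`, `N̄(1−κ) ≤ N ≤ N̄(1+κ)` on `S`;
  tail `t·∫Θ ≤ σ₂·Λ₀·g(x)` on `S`
⟹ ★★ `quasimode_of_twins`: (Q+) `∫M(x,·)Θ ≤ (((1+ε)(1+σ₁)+σ₂)/(1−κ))·(Λ₀/N̄)·Θ(x)w(x)` on `S` and (Q−) `((1−ε)(1−σ₁)/(1+κ))·(Λ₀/N̄)·Θ(x)w(x) ≤ ∫M(x,·)Θ` on `I` —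
ONE level `λ = Λ₀/N̄` for both halves (cdisprove R68), all corrections multiplicative `→ 1`.
HONEST FRAMING: bookkeeping for a stub of a child of the CONDITIONAL route R2b1; (Q±) OPEN until the slice bounds land; (B-ST), C4-CORE OPEN; not infinite volume, not a gap, not Clay.
-/

set_option autoImplicit false

noncomputable section

open MeasureTheory Filter Topology Real
open scoped BigOperators

namespace Summit.QuantumFields.YangMills.Theorems.FemtoTransferGap.TwoLattice.ConstTube

variable {L : ℕ} [NeZero L]

section Twins

variable {X : Type*} [MeasurableSpace X] {μ : Measure X} [IsFiniteMeasure μ]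
variable {M K : X → X → ℝ} {Θ w g N : X → ℝ} {S I : Set X} {CK CΘ ε t σ₁ σ₂ κ Λ₀ Nbar : ℝ}

omit [NeZero L] in
/-- ★★ **(Q±) FROM THE TWINS AND THE SLICE BOUNDS** (see the module docstring). [cite: Luscher1983, §3] -/
theorem quasimode_of_twins (hK : Measurable (Function.uncurry K)) (hKb : ∀ x y, |K x y| ≤ CK)
    (hΘ : Measurable Θ) (hΘb : ∀ x, |Θ x| ≤ CΘ) (hΘ0 : ∀ x, 0 ≤ Θ x) (hΘS : ∀ x, x ∉ S → Θ x = 0) (hIS : I ⊆ S)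
    (hMint : ∀ x ∈ S, Integrable (fun y => M x y * Θ y) μ)
    (hε : 0 ≤ ε) (hε1 : ε ≤ 1) (hσ₁ : 0 ≤ σ₁) (hσ₁1 : σ₁ ≤ 1) (hσ₂ : 0 ≤ σ₂) (hκ0 : 0 ≤ κ) (hκ : κ < 1) (hΛ₀ : 0 ≤ Λ₀) (hNbar : 0 < Nbar) (hg : ∀ x, 0 < g x)
    (hlo : ∀ x ∈ S, ∀ y ∈ S, (1 - ε) * K x y ≤ M x y) (hup : ∀ x ∈ S, ∀ y ∈ S, M x y ≤ (1 + ε) * K x y + t)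
    (hJup : ∀ x ∈ S, ∫ y, K x y * Θ y ∂μ ≤ (1 + σ₁) * Λ₀ * g x) (hJlo : ∀ x ∈ I, (1 - σ₁) * Λ₀ * g x ≤ ∫ y, K x y * Θ y ∂μ)
    (hΘw : ∀ x ∈ S, Θ x * w x = g x * N x) (hNlo : ∀ x ∈ S, Nbar * (1 - κ) ≤ N x) (hNup : ∀ x ∈ S, N x ≤ Nbar * (1 + κ))
    (htail : ∀ x ∈ S, t * ∫ y, Θ y ∂μ ≤ σ₂ * Λ₀ * g x) :
    (∀ x ∈ S, ∫ y, M x y * Θ y ∂μ ≤ ((1 + ε) * (1 + σ₁) + σ₂) / (1 - κ) * (Λ₀ / Nbar) * (Θ x * w x)) ∧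
      (∀ x ∈ I, (1 - ε) * (1 - σ₁) / (1 + κ) * (Λ₀ / Nbar) * (Θ x * w x) ≤ ∫ y, M x y * Θ y ∂μ) := by
  have h1κ : 0 < 1 - κ := by linarith
  -- integrability of the comparison integrands
  have hKi : ∀ x, Integrable (fun y => K x y * Θ y) μ := fun x =>
    integrable_of_measurable_abs_le μ ((hK.comp (measurable_const.prodMk measurable_id)).mul hΘ) (C := CK * CΘ) fun y => by
      rw [abs_mul]; exact mul_le_mul (hKb x y) (hΘb y) (abs_nonneg _) ((abs_nonneg _).trans (hKb x y))
  have hΘi : Integrable Θ μ := integrable_of_measurable_abs_le μ hΘ hΘb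
  constructor
  · intro x hx
    -- `∫MΘ ≤ (1+ε)∫KΘ + t∫Θ`
    have hstep : ∫ y, M x y * Θ y ∂μ ≤ (1 + ε) * ∫ y, K x y * Θ y ∂μ + t * ∫ y, Θ y ∂μ := by
      rw [← integral_const_mul, ← integral_const_mul, ← integral_add ((hKi x).const_mul _) (hΘi.const_mul _)]
      refine integral_mono (hMint x hx) (((hKi x).const_mul _).add (hΘi.const_mul _)) fun y => ?_
      show M x y * Θ y ≤ (1 + ε) * (K x y * Θ y) + t * Θ y
      by_cases hy : y ∈ S
      · have h := mul_le_mul_of_nonneg_right (hup x hx y hy) (hΘ0 y); nlinarith [h]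
      · rw [hΘS y hy]; simp
    have hg0 := (hg x).le
    have h2 : (1 + ε) * ∫ y, K x y * Θ y ∂μ + t * ∫ y, Θ y ∂μ ≤ ((1 + ε) * (1 + σ₁) + σ₂) * Λ₀ * g x := by
      have := mul_le_mul_of_nonneg_left (hJup x hx) (by linarith : (0:ℝ) ≤ 1 + ε)
      nlinarith [htail x hx]
    -- `Λ₀ g(x) = (Λ₀/N̄)·Θw·(N̄/N) ≤ (Λ₀/N̄)·Θw/(1−κ)`
    have hN0 : 0 < N x := lt_of_lt_of_le (by nlinarith) (hNlo x hx)
    have h3 : Λ₀ * g x ≤ (Λ₀ / Nbar) * (Θ x * w x) / (1 - κ) := by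
      rw [hΘw x hx, le_div_iff₀ h1κ]
      have e : Λ₀ / Nbar * (g x * N x) = Λ₀ * g x * (N x / Nbar) := by field_simp
      rw [e]
      have h4 : 1 - κ ≤ N x / Nbar := by rw [le_div_iff₀ hNbar]; linarith [hNlo x hx]
      exact mul_le_mul_of_nonneg_left h4 (mul_nonneg hΛ₀ hg0)
    calc ∫ y, M x y * Θ y ∂μ ≤ ((1 + ε) * (1 + σ₁) + σ₂) * Λ₀ * g x := hstep.trans h2
      _ = ((1 + ε) * (1 + σ₁) + σ₂) * (Λ₀ * g x) := by ring
      _ ≤ ((1 + ε) * (1 + σ₁) + σ₂) * ((Λ₀ / Nbar) * (Θ x * w x) / (1 - κ)) := mul_le_mul_of_nonneg_left h3 (by positivity)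
      _ = ((1 + ε) * (1 + σ₁) + σ₂) / (1 - κ) * (Λ₀ / Nbar) * (Θ x * w x) := by field_simp
  · intro x hx
    have hxS := hIS hx
    -- `∫MΘ ≥ (1−ε)∫KΘ ≥ (1−ε)(1−σ₁)Λ₀ g`
    have hstep : (1 - ε) * ∫ y, K x y * Θ y ∂μ ≤ ∫ y, M x y * Θ y ∂μ := by
      rw [← integral_const_mul]
      refine integral_mono ((hKi x).const_mul _) (hMint x hxS) fun y => ?_
      show (1 - ε) * (K x y * Θ y) ≤ M x y * Θ y
      by_cases hy : y ∈ S
      · have h := mul_le_mul_of_nonneg_right (hlo x hxS y hy) (hΘ0 y); nlinarith [h]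
      · rw [hΘS y hy]; simp
    have hg0 := (hg x).le
    have hN0 : 0 < N x := lt_of_lt_of_le (by nlinarith) (hNlo x hxS)
    -- `(Λ₀/N̄)Θw/(1+κ) ≤ Λ₀ g`
    have h3 : (Λ₀ / Nbar) * (Θ x * w x) / (1 + κ) ≤ Λ₀ * g x := by
      rw [hΘw x hxS, div_le_iff₀ (by linarith)]
      have e : Λ₀ / Nbar * (g x * N x) = Λ₀ * g x * (N x / Nbar) := by field_simp
      rw [e]
      have h4 : N x / Nbar ≤ 1 + κ := by rw [div_le_iff₀ hNbar]; linarith [hNup x hxS]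
      exact mul_le_mul_of_nonneg_left h4 (mul_nonneg hΛ₀ hg0)
    calc (1 - ε) * (1 - σ₁) / (1 + κ) * (Λ₀ / Nbar) * (Θ x * w x) = (1 - ε) * (1 - σ₁) * ((Λ₀ / Nbar) * (Θ x * w x) / (1 + κ)) := by field_simp
      _ ≤ (1 - ε) * (1 - σ₁) * (Λ₀ * g x) := mul_le_mul_of_nonneg_left h3 (mul_nonneg (by linarith) (by linarith))
      _ = (1 - ε) * ((1 - σ₁) * Λ₀ * g x) := by ring
      _ ≤ (1 - ε) * ∫ y, K x y * Θ y ∂μ := mul_le_mul_of_nonneg_left (hJlo x hx) (by linarith)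
      _ ≤ _ := hstep

end Twins

end Summit.QuantumFields.YangMills.Theorems.FemtoTransferGap.TwoLattice.ConstTube

end
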